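import Summits.KontsevichZagierPeriods.Zeta5Search.RVFlatGaugeWindow
import HarnessLib

/-!
# RVFlatGaugeCapLemmas — bookkeeping for the FLAT `S₇`-gauge law with LARGE lower parameters (fam-rv gen 8, file 1/4)

HONEST FRAMING: systematic search; no irrationality claim unless certified.  Pure arithmetic lemmas about the tree's
definitions (`forms28`, `m5`, `eD`, `eDflat`, `rhoB`, `scheme`, `Window.T4`); no statement minted by this cell is used,
no γ / measure claim is made.  Consumed by `RVFlatGaugeCapCore.lean` / `RVFlatGaugeCap.lean` (THEOREM W⁺: fam-rv
gen-7's THEOREM W `flatGaugeLaw_of_window` with the hypothesis "all seven lower parameters `< p`" replaced by the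
CAPACITY hypothesis `#{k : b_k ≥ p} + [2p ≤ d] ≤ 3`, resp. by the DISJOINTNESS hypothesis of that file).

CONTENTS (all PROVED, no placeholders).
* `Cap.all_ge_of_countP`, `Cap.le_T4_of_countP` — in a `≥`-sorted list with at least `k` entries `≥ p`, the first `k`
  entries are `≥ p`; hence `min(4,k) ≤ T4` (generalises gen-7's `one_le_T4` / `two_le_T4`) and (`k ≥ 5`) `p ≤ m₅`
  (`Cap.le_m5_of_countP`).
* `Cap.card_le_countP` — a finset of scheme entries satisfying `q` bounds `scheme.countP q` from below.
* `Cap.denSum`, `Cap.padicValRat_rhoB_midParams` — Legendre below `p²` on ALL twenty-one factorials of gen-1's closed scalar: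
  `v_p ρ(c) = Σ_{(j,k)∈E} ⌊(c₀−c_j−c_k)/p⌋ − Σ_{j∈{1,4,5,6,7}} ⌊c_j/p⌋ − ⌊d/p⌋` for `c` in the polytope, `p` odd,
  `c₀ + 2 < p²`, `d < p²` (gen-7's `padicValRat_rhoB_smallParams` is the case where the five `c_j!` are units).
* `Cap.nbig`, `Cap.nbig_permLower` — the number of lower parameters `≥ p`, an `S₇`-invariant.
-/

namespace Summit.KontsevichZagierPeriods.Zeta5Search.RVFlatGauge

open Finset
open Summit.KontsevichZagierPeriods.Zeta5Search.CasoratianValuation (casoratian shift InPolytope pairFloors refund)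
open Summit.KontsevichZagierPeriods.Zeta5Search.WedgeDictionary (dOf Epairs)
open Summit.KontsevichZagierPeriods.Zeta5Search.SymmetricGauge
open Summit.KontsevichZagierPeriods.Zeta5Search.DualSeries (InBox)
open Window

namespace Cap

/-! ### Sorted lists: the first `k` entries of a list with `k` entries `≥ p` -/

/-- In a `≥`-sorted list with at least `k` entries `≥ p`, every one of the first `k` entries is `≥ p`. -/
theorem all_ge_of_countP {p : ℕ} {s : List ℤ} (hsort : s.Pairwise (· ≥ ·)) {k : ℕ}
    (hc : k ≤ s.countP (fun y => decide ((p : ℤ) ≤ y))) : ∀ y ∈ s.take k, (p : ℤ) ≤ y := by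
  intro y hy
  by_contra hlt
  rw [not_le] at hlt
  have hsplit : s.countP (fun y => decide ((p : ℤ) ≤ y)) =
      (s.take k).countP (fun y => decide ((p : ℤ) ≤ y)) + (s.drop k).countP (fun y => decide ((p : ℤ) ≤ y)) := by
    rw [← List.countP_append, List.take_append_drop]
  have hpair : (s.take k ++ s.drop k).Pairwise (· ≥ ·) := by rwa [List.take_append_drop]
  have hdrop : (s.drop k).countP (fun y => decide ((p : ℤ) ≤ y)) = 0 :=
    List.countP_eq_zero.2 fun z hz => by
      have hzy : y ≥ z := (List.pairwise_append.1 hpair).2.2 y hy z hz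
      simp only [decide_eq_true_eq, not_le]
      omega
  have hlen := List.length_eq_countP_add_countP (l := s.take k) (fun y => decide ((p : ℤ) ≤ y))
  have hneg : 0 < (s.take k).countP (fun y => ¬ decide ((p : ℤ) ≤ y)) :=
    List.countP_pos_iff.2 ⟨y, hy, by simp; omega⟩
  have htk : (s.take k).length ≤ k := List.length_take_le _ _
  omega

/-- `min(4,k) ≤ T4` when at least `k` entries of the `≥`-sorted list are `≥ p` (`T4` = `⌊log_p⌋`-charge of the top four). -/
theorem le_T4_of_countP {p : ℕ} (hp : 1 < p) {s : List ℤ} (hsort : s.Pairwise (· ≥ ·)) {k : ℕ} (hk : k ≤ 4)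
    (hc : k ≤ s.countP (fun y => decide ((p : ℤ) ≤ y))) : (k : ℤ) ≤ T4 p s := by
  have hall := all_ge_of_countP hsort hc
  have hlen : k ≤ s.length := hc.trans List.countP_le_length
  have hlk : (s.take k).length = k := List.length_take_of_le hlen
  set f : ℤ → ℤ := fun m => (Nat.log p m.toNat : ℤ) with hf
  have hsplit : ((s.take 4).map f).sum = (((s.take 4).take k).map f).sum + (((s.take 4).drop k).map f).sum := by
    rw [← List.sum_append, ← List.map_append, List.take_append_drop]
  have htk : (s.take 4).take k = s.take k := by rw [List.take_take, Nat.min_eq_left hk]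
  have hrest : 0 ≤ (((s.take 4).drop k).map f).sum :=
    List.sum_nonneg fun x hx => by
      obtain ⟨m, -, rfl⟩ := List.mem_map.1 hx
      positivity
  have hmain : ((s.take k).map f).length • (1 : ℤ) ≤ ((s.take k).map f).sum :=
    List.card_nsmul_le_sum _ _ fun x hx => by
      obtain ⟨m, hm, rfl⟩ := List.mem_map.1 hx
      exact one_le_log_of_le hp (hall m hm)
  rw [List.length_map, hlk, nsmul_eq_mul, mul_one] at hmain
  show (k : ℤ) ≤ ((s.take 4).map f).sum
  rw [hsplit, htk]
  linarith

/-- Five entries `≥ p` in the `≥`-sorted list put `p` below its fifth entry `getD 4 0` (= `m₅` for the sorted forms). -/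
theorem le_getD_four_of_countP {p : ℕ} {s : List ℤ} (hsort : s.Pairwise (· ≥ ·))
    (hc : 5 ≤ s.countP (fun y => decide ((p : ℤ) ≤ y))) : (p : ℤ) ≤ s.getD 4 0 := by
  have hall := all_ge_of_countP hsort hc
  have hlen : 5 ≤ s.length := hc.trans List.countP_le_length
  rcases s with _ | ⟨a₀, _ | ⟨a₁, _ | ⟨a₂, _ | ⟨a₃, _ | ⟨a₄, t⟩⟩⟩⟩⟩ <;> simp at hlen
  exact hall a₄ (by simp)

/-- Five of the 28 forms `≥ p` give `p ≤ m₅`. -/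
theorem le_m5_of_countP {p : ℕ} (c : ℕ → ℤ)
    (hc : 5 ≤ ((forms28 c).insertionSort (· ≥ ·)).countP (fun y => decide ((p : ℤ) ≤ y))) : (p : ℤ) ≤ m5 c := by
  unfold m5
  exact le_getD_four_of_countP (List.pairwise_insertionSort _ _) hc

/-- A finset of list members satisfying `q` bounds `countP q` from below. -/
theorem card_le_countP {α : Type*} [DecidableEq α] (l : List α) (q : α → Bool) (T : Finset α)
    (hT : ∀ t ∈ T, t ∈ l ∧ q t = true) : T.card ≤ l.countP q := by
  rw [List.countP_eq_length_filter]
  have hsub : T ⊆ (l.filter q).toFinset := fun t ht => by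
    rw [List.mem_toFinset, List.mem_filter]; exact hT t ht
  exact (Finset.card_le_card hsub).trans (List.toFinset_card_le _)

/-- A single slot is a scheme entry, evaluating to its lower parameter. -/
theorem inl_mem_scheme (k : Fin 7) : (Sum.inl k : Idx) ∈ scheme :=
  List.mem_append_left _ (List.mem_map.2 ⟨k, List.mem_finRange k, rfl⟩)

/-- `ev c (inl k) = c_{k+1}`. -/
theorem ev_inl (c : ℕ → ℤ) (k : Fin 7) : ev c (Sum.inl k) = c (k.val + 1) := rfl

/-! ### `v_p(ρ(c))` with lower parameters below `p²` -/

/-- The denominator floors `Σ_{j ∈ {1,4,5,6,7}} ⌊c_j/p⌋` of gen-1's closed scalar. -/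
def denSum (c : ℕ → ℤ) (p : ℕ) : ℤ := ((([1, 4, 5, 6, 7] : List ℕ)).map fun j => c j / (p : ℤ)).sum

/-- **`v_p(ρ(c)) = Σ_{(j,k)∈E} ⌊(c₀−c_j−c_k)/p⌋ − Σ_{j∈{1,4,5,6,7}} ⌊c_j/p⌋ − ⌊d(c)/p⌋`** for an odd prime `p`, `c` in the
polytope, `c₀ + 2 < p²`, `d(c) < p²` (Legendre below `p²` on each of the twenty-one factorials; no smallness of the `c_j`). -/
theorem padicValRat_rhoB_midParams {c : ℕ → ℤ} (hc : InPolytope c) {p : ℕ} (hp : p.Prime) (hp2 : p ≠ 2)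
    (hwin : (c 0 + 2 : ℤ) < (p : ℤ) ^ 2) (hd : dOf c < (p : ℤ) ^ 2) :
    padicValRat p (rhoB c) = eSum c p - denSum c p - dOf c / p := by
  haveI : Fact p.Prime := ⟨hp⟩
  obtain ⟨⟨h00, hbox⟩, hhalf, hsum⟩ := hc
  have hnn : ∀ j, 1 ≤ j → j ≤ 7 → 0 ≤ c j ∧ 2 * c j ≤ c 0 := by
    intro j hj1 hj7
    obtain ⟨i, rfl⟩ : ∃ i, j = i + 1 := ⟨j - 1, by omega⟩
    exact ⟨(hbox i (mem_range.2 (by omega))).1, hhalf i (mem_range.2 (by omega))⟩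
  have hd0 : 0 ≤ dOf c := by unfold dOf; linarith
  set N : ℕ := (Epairs.map fun jk => (c 0 - c jk.1 - c jk.2).toNat.factorial).prod with hN
  set M : ℕ := (([1, 4, 5, 6, 7] : List ℕ).map fun j => (c j).toNat.factorial).prod with hM
  set D : ℕ := (dOf c).toNat.factorial with hD
  have hrho : rhoB c = ((-1 : ℚ) ^ (∑ j ∈ range 7, c (j + 1)).toNat * (N : ℚ)) / ((4 * M : ℕ) * (D : ℚ)) := by
    unfold rhoB
    simp only [hN, hM, hD, Epairs, List.map, List.prod_cons, List.prod_nil]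
    push_cast
    ring
  have hNpos : 0 < N := by
    rw [hN]; exact List.prod_pos fun x hx => by
      obtain ⟨jk, -, rfl⟩ := List.mem_map.1 hx; exact Nat.factorial_pos _
  have hMpos : 0 < M := by
    rw [hM]; exact List.prod_pos fun x hx => by
      obtain ⟨j, -, rfl⟩ := List.mem_map.1 hx; exact Nat.factorial_pos _
  have hDpos : 0 < D := Nat.factorial_pos _
  have hmem5 : ∀ j ∈ ([1, 4, 5, 6, 7] : List ℕ), 1 ≤ j ∧ j ≤ 7 := by
    intro j hj; simp only [List.mem_cons, List.mem_nil_iff, or_false] at hj; omega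
  -- valuations of the pieces
  have vN : padicValNat p N = (Epairs.map fun jk => (c 0 - c jk.1 - c jk.2).toNat / p).sum := by
    rw [hN, padicValNat_prod_map p _ _ (fun jk _ => Nat.factorial_ne_zero _)]
    refine congrArg List.sum (List.map_congr_left fun jk hjk => ?_)
    obtain ⟨h1, h7, h1', h7', _⟩ := epairs_range jk hjk
    obtain ⟨hj0, _⟩ := hnn jk.1 h1 h7
    obtain ⟨hk0, _⟩ := hnn jk.2 h1' h7'
    apply padicValNat_factorial_of_lt_sq
    have hq : (((c 0 - c jk.1 - c jk.2).toNat : ℕ) : ℤ) < (p : ℤ) ^ 2 := by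
      rw [Int.toNat_of_nonneg (by omega)]; omega
    exact_mod_cast hq
  have h4 : padicValNat p 4 = 0 := by
    apply padicValNat.eq_zero_of_not_dvd
    intro h
    have h' : p ∣ 2 ^ 2 := by norm_num; exact h
    exact hp2 ((Nat.prime_dvd_prime_iff_eq hp Nat.prime_two).1 (hp.dvd_of_dvd_pow h'))
  have vM : padicValNat p (4 * M) = (([1, 4, 5, 6, 7] : List ℕ).map fun j => (c j).toNat / p).sum := by
    rw [padicValNat.mul (by norm_num) hMpos.ne', h4, zero_add, hM,
      padicValNat_prod_map p _ _ (fun j _ => Nat.factorial_ne_zero _)]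
    refine congrArg List.sum (List.map_congr_left fun j hj => ?_)
    obtain ⟨hj1, hj7⟩ := hmem5 j hj
    obtain ⟨hj0, hj2⟩ := hnn j hj1 hj7
    apply padicValNat_factorial_of_lt_sq
    have hq : (((c j).toNat : ℕ) : ℤ) < (p : ℤ) ^ 2 := by
      rw [Int.toNat_of_nonneg hj0]; omega
    exact_mod_cast hq
  have vD : padicValNat p D = (dOf c).toNat / p := by
    apply padicValNat_factorial_of_lt_sq
    have hq : (((dOf c).toNat : ℕ) : ℤ) < (p : ℤ) ^ 2 := by rw [Int.toNat_of_nonneg hd0]; exact hd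
    exact_mod_cast hq
  -- assemble
  have hNq : (N : ℚ) ≠ 0 := by exact_mod_cast hNpos.ne'
  have hsq : ((-1 : ℚ)) ^ (∑ j ∈ range 7, c (j + 1)).toNat ≠ 0 := pow_ne_zero _ (by norm_num)
  have hnum : ((-1 : ℚ)) ^ (∑ j ∈ range 7, c (j + 1)).toNat * (N : ℚ) ≠ 0 := mul_ne_zero hsq hNq
  have h4M : ((4 * M : ℕ) : ℚ) ≠ 0 := by exact_mod_cast (show 4 * M ≠ 0 by omega)
  have hDq : (D : ℚ) ≠ 0 := by exact_mod_cast hDpos.ne'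
  have hden : ((4 * M : ℕ) : ℚ) * (D : ℚ) ≠ 0 := mul_ne_zero h4M hDq
  have v1 : padicValRat p ((-1 : ℚ) ^ (∑ j ∈ range 7, c (j + 1)).toNat) = 0 := by
    rcases neg_one_pow_eq_or ℚ ((∑ j ∈ range 7, c (j + 1)).toNat) with h | h <;>
      simp [h, padicValRat.neg]
  have hE : (((Epairs.map fun jk => (c 0 - c jk.1 - c jk.2).toNat / p).sum : ℕ) : ℤ) = eSum c p := by
    unfold eSum
    rw [Nat.cast_list_sum, List.map_map]
    refine congrArg List.sum (List.map_congr_left fun jk hjk => ?_)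
    obtain ⟨h1, h7, h1', h7', _⟩ := epairs_range jk hjk
    obtain ⟨hj0, hj2⟩ := hnn jk.1 h1 h7
    obtain ⟨hk0, hk2⟩ := hnn jk.2 h1' h7'
    simp only [Function.comp_apply, Int.natCast_div]
    rw [Int.toNat_of_nonneg (by omega)]
  have hDen : (((([1, 4, 5, 6, 7] : List ℕ).map fun j => (c j).toNat / p).sum : ℕ) : ℤ) = denSum c p := by
    unfold denSum
    rw [Nat.cast_list_sum, List.map_map]
    refine congrArg List.sum (List.map_congr_left fun j hj => ?_)
    obtain ⟨hj1, hj7⟩ := hmem5 j hj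
    obtain ⟨hj0, _⟩ := hnn j hj1 hj7
    simp only [Function.comp_apply, Int.natCast_div]
    rw [Int.toNat_of_nonneg hj0]
  have hDc : (((dOf c).toNat / p : ℕ) : ℤ) = dOf c / p := by
    rw [Int.natCast_div, Int.toNat_of_nonneg hd0]
  rw [hrho, padicValRat.div hnum hden, padicValRat.mul hsq hNq, padicValRat.mul h4M hDq, v1,
    padicValRat.of_nat, padicValRat.of_nat, padicValRat.of_nat, vN, vM, vD, hE, hDen, hDc]
  ring

/-! ### The number of large lower parameters -/

/-- `nbig(c,p) = #{k ∈ {1,…,7} : c_k ≥ p}` (slot `k : Fin 7` ↦ `c_{k+1}`). -/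
def nbig (c : ℕ → ℤ) (p : ℕ) : ℕ := (univ.filter fun k : Fin 7 => (p : ℤ) ≤ c (k.val + 1)).card

/-- `nbig` is `S₇`-invariant. -/
theorem nbig_permLower (σ : Equiv.Perm (Fin 7)) (b : ℕ → ℤ) (p : ℕ) : nbig (permLower σ b) p = nbig b p := by
  unfold nbig
  have h : (univ.filter fun k : Fin 7 => (p : ℤ) ≤ permLower σ b (k.val + 1)) =
      (univ.filter fun k : Fin 7 => (p : ℤ) ≤ b (k.val + 1)).map σ.symm.toEmbedding := by
    ext k
    rw [mem_map_equiv, mem_filter, mem_filter, permLower_apply_succ, Equiv.symm_symm]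
    simp
  rw [h, card_map]

/-- All seven lower parameters `< p` means `nbig = 0` (gen-7's window hypothesis). -/
theorem nbig_eq_zero_of_small {c : ℕ → ℤ} {p : ℕ} (hsmall : ∀ k ∈ range 7, c (k + 1) < p) : nbig c p = 0 := by
  unfold nbig
  rw [Finset.card_eq_zero, Finset.filter_eq_empty_iff]
  intro k _
  have := hsmall k.val (mem_range.2 k.isLt)
  omega

end Cap

end Summit.KontsevichZagierPeriods.Zeta5Search.RVFlatGauge
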